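import Summits.CriticalPhenomena.PercolationContinuityZ3.Theorems.PercNearOneGluingNoHeavyLowerTailSahiOneStepFibreThresholdAll
import Summits.CriticalPhenomena.PercolationContinuityZ3.Theorems.PercNearOneGluingNoHeavyLowerTailSahiOneStepFibreF3Reduce
import HarnessLib

/-!
# One-step scheme: Kahn C5 / Sahi C₃ for threshold first slots of ANY size, CONDITIONAL ONLY on the three-copy fibre inequality `(F3)`

Support file (prover prim-ineq-prove-3 gen 17; `--supports stmt-CriticalPhenomena-4575`; memo
`run/shared/lean/prim/prim-ineq-prove-3/FINDING-G17-THRESHOLD-ALL.md` §0, §2).  No definitions, no named facts, no sorries, no `native_decide`.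

After `…SahiOneStepFibreThresholdAll` (the `(3′)` half for every threshold slot in every dimension, unconditionally) the only remaining input of
the one-step scheme for `H = Th_t(F)` is the `(2′)` half, which `…FibreF3Reduce.osN_threshold_nonneg_of_f3` reduces to the nonnegativity of the
three-copy fibre forms `f3sum ℝ D₁ D₂ θ 1_U 1_V` on pairs of upper families of `2^{D₁ ∪ D₂}`, `D₁ ∪ D₂ ⊆ F`.  This file records the resulting
implications once and for all:
* `sahiE3_threshold_nonneg_of_f3sum_nonneg_le`: if the fibre forms with `|D₁| + |D₂| ≤ n` are nonnegative, then `E₃(Th_t(F), A, B) ≥ 0` for every `F`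
  with `|F| ≤ n`, every `t`, every product measure and ALL increasing `A, B` (for `n = 5` this re-derives `…ThresholdFiveN`; a verified `n = 6, 7, …`
  plugs in directly);
* `sahiE3_threshold_nonneg_of_f3sum_nonneg`: if they are nonnegative for all `D₁, D₂` (conjecture `(F3)` of the memo, verified through `|D| = 7`), then
  Kahn's Conjecture 5 / Sahi's `C₃` holds for EVERY threshold first slot — majority of any size included.
-/

noncomputable section

namespace Summit.CriticalPhenomena.PercolationContinuityZ3.Theorems

namespace SahiOneStep

open MeasureTheory Finset
open Literature.Probability.Percolation (DeterminedBy)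
open Literature.Probability.LatticeModels (prodBernoulli sahiE3)
open Literature.Probability.Percolation.DecisionTree (ind)
open scoped Classical

variable {ι : Type*} [Fintype ι] [DecidableEq ι]

/-- **Threshold slots of size `≤ n` from the fibre forms of size `≤ n`.**  If `f3sum ℝ D₁ D₂ θ 1_U 1_V ≥ 0` for all disjoint `D₁, D₂` with
`|D₁| + |D₂| ≤ n`, all `θ` and all pairs of upper families `U, V` of `2^{D₁ ∪ D₂}`, then `E₃(Th_t(F), A, B) ≥ 0` for every `F` with `|F| ≤ n`, every `t`,
every product measure and all increasing `A, B`. [this work] -/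
theorem sahiE3_threshold_nonneg_of_f3sum_nonneg_le (n : ℕ)
    (hF3 : ∀ D₁ D₂ : Finset ι, Disjoint D₁ D₂ → D₁.card + D₂.card ≤ n → ∀ θ : ℕ, ∀ U V : Finset (Finset ι),
      U ⊆ (D₁ ∪ D₂).powerset → (∀ S ∈ U, ∀ T ∈ (D₁ ∪ D₂).powerset, S ⊆ T → T ∈ U) →
      V ⊆ (D₁ ∪ D₂).powerset → (∀ S ∈ V, ∀ T ∈ (D₁ ∪ D₂).powerset, S ⊆ T → T ∈ V) →
      0 ≤ f3sum ℝ D₁ D₂ θ (fun S => if S ∈ U then 1 else 0) (fun S => if S ∈ V then 1 else 0))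
    (p : ι → unitInterval) (F : Finset ι) (hF : F.card ≤ n) (t : ℕ) {A B : Set (Set ι)} (hA : IsUpperSet A) (hB : IsUpperSet B) :
    0 ≤ sahiE3 (prodBernoulli p) {ω : Set ι | t ≤ (F.filter (· ∈ ω)).card} A B := by
  refine sahiE3_nonneg_of_ind p (determinedBy_threshold F t)
    (fun _ _ hA' hB' hAF hBF => osMp_threshold_nonneg p F t hA' hB' hAF hBF)
    (fun _ _ hA' hB' hAF hBF => ?_) hA hB
  refine osN_threshold_nonneg_of_f3 p F t hA' hB' hAF hBF fun D₁ D₂ hDF hdisj θ U V hU hUup hV hVup => ?_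
  have hcard : D₁.card + D₂.card ≤ n := by
    rw [← Finset.card_union_of_disjoint hdisj]
    exact (Finset.card_le_card hDF).trans hF
  exact hF3 D₁ D₂ hdisj hcard θ U V hU hUup hV hVup

/-- **KAHN C5 / SAHI C₃ FOR EVERY THRESHOLD FIRST SLOT, CONDITIONAL ON `(F3)`.**  If the three-copy fibre forms are nonnegative on all pairs of upper
families for all disjoint `D₁, D₂` and all `θ`, then for every finite `ι`, every `p : ι → [0,1]`, every `F`, every `t` and ALL increasing `A, B ⊆ 2^ι`:
`E₃(Th_t(F), A, B) ≥ 0`. [this work] -/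
theorem sahiE3_threshold_nonneg_of_f3sum_nonneg
    (hF3 : ∀ D₁ D₂ : Finset ι, Disjoint D₁ D₂ → ∀ θ : ℕ, ∀ U V : Finset (Finset ι),
      U ⊆ (D₁ ∪ D₂).powerset → (∀ S ∈ U, ∀ T ∈ (D₁ ∪ D₂).powerset, S ⊆ T → T ∈ U) →
      V ⊆ (D₁ ∪ D₂).powerset → (∀ S ∈ V, ∀ T ∈ (D₁ ∪ D₂).powerset, S ⊆ T → T ∈ V) →
      0 ≤ f3sum ℝ D₁ D₂ θ (fun S => if S ∈ U then 1 else 0) (fun S => if S ∈ V then 1 else 0))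
    (p : ι → unitInterval) (F : Finset ι) (t : ℕ) {A B : Set (Set ι)} (hA : IsUpperSet A) (hB : IsUpperSet B) :
    0 ≤ sahiE3 (prodBernoulli p) {ω : Set ι | t ≤ (F.filter (· ∈ ω)).card} A B :=
  sahiE3_threshold_nonneg_of_f3sum_nonneg_le F.card (fun D₁ D₂ hd _ θ U V hU hUup hV hVup => hF3 D₁ D₂ hd θ U V hU hUup hV hVup)
    p F le_rfl t hA hB

/-- **Majority of any odd size, conditional on `(F3)`**: first slot `maj_{2r+1} = {ω | r + 1 ≤ #(F ∩ ω)}`, `|F| = 2r + 1`. [this work] -/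
theorem sahiE3_majority_nonneg_of_f3sum_nonneg
    (hF3 : ∀ D₁ D₂ : Finset ι, Disjoint D₁ D₂ → ∀ θ : ℕ, ∀ U V : Finset (Finset ι),
      U ⊆ (D₁ ∪ D₂).powerset → (∀ S ∈ U, ∀ T ∈ (D₁ ∪ D₂).powerset, S ⊆ T → T ∈ U) →
      V ⊆ (D₁ ∪ D₂).powerset → (∀ S ∈ V, ∀ T ∈ (D₁ ∪ D₂).powerset, S ⊆ T → T ∈ V) →
      0 ≤ f3sum ℝ D₁ D₂ θ (fun S => if S ∈ U then 1 else 0) (fun S => if S ∈ V then 1 else 0))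
    (p : ι → unitInterval) (F : Finset ι) (r : ℕ) (_hF : F.card = 2 * r + 1) {A B : Set (Set ι)} (hA : IsUpperSet A) (hB : IsUpperSet B) :
    0 ≤ sahiE3 (prodBernoulli p) {ω : Set ι | r + 1 ≤ (F.filter (· ∈ ω)).card} A B :=
  sahiE3_threshold_nonneg_of_f3sum_nonneg hF3 p F (r + 1) hA hB

end SahiOneStep

end Summit.CriticalPhenomena.PercolationContinuityZ3.Theorems
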